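import Literature.Geometry.Riemannian.HeatKernelGaussianConcentration
import Literature.Geometry.Riemannian.RiemannianMetricSpace
import HarnessLib

/-!
# Hein–Naber two-set concentration with near-minimizing points
# (Bamler 2020a, §7.3, proof of the Gaussian lemma, (7.21)–(7.22))

R. Bamler, *Entropy and heat kernel bounds on a Ricci flow background*, arXiv:2008.07093 (2020a),
§7.3, proof of the Gaussian lemma (Lemma 7.20 / arXiv Lemma 28), displays (7.21)–(7.22): "applying
[Hein–Naber-14] … `ν(V₁ ∩ B') ν(V₂ ∩ B') ≤ C exp(−d²_θ(V₁ ∩ B', V₂ ∩ B') / (8 (1 − θ)))` … Choose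
points `v_i ∈ V_i ∩ B'` such that `d_θ(v₁, v₂) = d_θ(V₁ ∩ B', V₂ ∩ B')`".

The tree's Gaussian concentration theorem of Hein–Naber (`heatKernelMeasure_real_mul_real_le_exp`,
`HeatKernelGaussianConcentration.lean`) is stated with a separating `1`-Lipschitz witness `ψ`.
This file packages it with the **set distance** `d_s(A, B)` of two nonempty measurable sets and
returns **near-minimizing points**: for a Ricci flow `hflow = (h, cov)` on `[a, T]` of a `C^∞`
family of Riemannian metrics on a closed connected manifold `M` (modelled on `ℝᵐ`),
`a < s < t ≤ T`, `ν = ν_{x,t;s} = heatKernelMeasure hh hR t x s`, and nonempty measurable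
`A, B ⊆ M` there are `v₁ ∈ A`, `v₂ ∈ B` with

  `ν(A) ν(B) ≤ e^{1/2} exp(−d_s(v₁, v₂)² / (8 (t − s)))`

(`exists_mem_real_mul_real_le_exp_neg_edist_sq`). Exact minimizers of `d_s` between merely
measurable sets need not exist, so we pay the harmless factor `e^{1/2}`: with
`ψ = d_s(·, A)` (`Metric.infDist` for the metric space `(M, d_{h(s)})`,
`PseudoRiemannianMetric.metricSpace`), `D = inf_B ψ = d_s(A, B)`, Hein–Naber gives
`ν(A) ν(B) ≤ exp(−D² / (8 (t − s)))`, and points `v₂ ∈ B`, `v₁ ∈ A` with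
`d_s(v₁, v₂) < D + 2δ`, `δ (D + 1) ≤ t − s`, `δ ≤ 1`, satisfy `d_s(v₁, v₂)² − D² ≤ 4 (t − s)`.

Everything is proved; no definitions, no named facts. What is NOT here: Bamler's constant
bookkeeping of (7.22)–(7.23), `H_n`-centres, non-compact `M`.

## References

* R. H. Bamler, *Entropy and heat kernel bounds on a Ricci flow background*, arXiv:2008.07093
  (2020), §7.3, proof of the Gaussian lemma, (7.21)–(7.22). [Bamler2020Entropy]
* H.-J. Hein, A. Naber, *New logarithmic Sobolev inequalities and an ε-regularity theorem for the
  Ricci flow*, Comm. Pure Appl. Math. 67 (2014), 1543–1561, §1.3 (Gaussian concentration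
  theorem). [HeinNaber2014]
-/

noncomputable section

open Set Filter Function MeasureTheory Measure
open scoped Manifold ContDiff Topology ENNReal NNReal

namespace Literature.Geometry.Riemannian

open Lorentzian Lorentzian.PseudoRiemannianMetric

/-! ### The real bookkeeping: from the set distance to a near-minimizing pair -/

/-- **Bookkeeping for near-minimizers**: if `0 ≤ dv < D + 2δ` with `0 < δ ≤ 1` and
`δ (D + 1) ≤ σ`, then `dv² − D² ≤ 4σ`, hence
`exp(−D² / (8σ)) ≤ e^{1/2} exp(−dv² / (8σ))`. [folklore] -/
theorem exp_neg_sq_div_le_exp_half_mul_exp_neg_sq_div {D dv δ σ : ℝ} (hσ : 0 < σ)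
    (hdv : 0 ≤ dv) (hδ : 0 < δ) (hδ1 : δ ≤ 1) (hδσ : δ * (D + 1) ≤ σ) (hlt : dv < D + 2 * δ) :
    Real.exp (-D ^ 2 / (8 * σ)) ≤ Real.exp (1 / 2) * Real.exp (-dv ^ 2 / (8 * σ)) := by
  rw [← Real.exp_add, Real.exp_le_exp]
  have h1 : dv ^ 2 ≤ (D + 2 * δ) ^ 2 := pow_le_pow_left₀ hdv hlt.le 2
  have h2 : δ ^ 2 ≤ δ := by nlinarith
  have key : dv ^ 2 - D ^ 2 ≤ 4 * σ := by nlinarith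
  have h8 : 0 < 8 * σ := by positivity
  have h3 : -D ^ 2 / (8 * σ) - -dv ^ 2 / (8 * σ) ≤ 1 / 2 := by
    rw [← sub_div, div_le_iff₀ h8]
    linarith
  linarith

section Kernel

variable {m : ℕ} {H : Type*} [TopologicalSpace H]
  {I : ModelWithCorners ℝ (EuclideanSpace ℝ (Fin m)) H} [I.Boundaryless]
  {M : Type*} [TopologicalSpace M] [ChartedSpace H M] [IsManifold I ∞ M]
  [T2Space M] [CompactSpace M] [SecondCountableTopology M] [MeasurableSpace M] [BorelSpace M]
  [ConnectedSpace M]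
  {h : ℝ → PseudoRiemannianMetric I ∞ (EuclideanSpace ℝ (Fin m)) (TangentSpace I : M → Type _)}
  {cov : ℝ → CovariantDerivative I (EuclideanSpace ℝ (Fin m)) (TangentSpace I : M → Type _)}
  {a T : ℝ} (hflow : IsRicciFlow h cov (Icc a T)) (hh : IsContMDiffFamilyOn ∞ h univ)
  (hR : ∀ r, (h r).IsRiemannian)

/-! ### Hein–Naber two-set concentration with near-minimizing points -/

include hflow in
/-- **Hein–Naber two-set concentration with near-minimizing points** (Bamler 2020a, §7.3, proof
of the Gaussian lemma, (7.21)–(7.22): "applying [Hein–Naber-14] …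
`≤ C exp(−d²_θ(V₁ ∩ B', V₂ ∩ B')/(8(1 − θ)))` … Choose points `v_i ∈ V_i ∩ B'` such that
`d_θ(v₁, v₂) = d_θ(V₁ ∩ B', V₂ ∩ B')`"). Let `(h, cov)` be a Ricci flow on `[a, T]` of a smooth
family of Riemannian metrics on a closed connected manifold `M`, `a < s < t ≤ T`, `x ∈ M`,
`ν = ν_{x,t;s}` the conjugate heat kernel measure, and `A, B ⊆ M` nonempty measurable sets. Then
there are `v₁ ∈ A`, `v₂ ∈ B` with

  `ν(A) ν(B) ≤ e^{1/2} exp(−d_{h(s)}(v₁, v₂)² / (8 (t − s)))`.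

Proof: Hein–Naber's Gaussian concentration `heatKernelMeasure_real_mul_real_le_exp` with the
`1`-Lipschitz witness `ψ = d_s(·, A)` (`Metric.infDist` in the metric space `(M, d_{h(s)})`),
`α = 0`, `d = D = inf_B ψ`, and near-minimizers `v₂ ∈ B` (`ψ v₂ < D + δ`), `v₁ ∈ A`
(`d_s(v₂, v₁) < ψ v₂ + δ`) with `δ = min 1 ((t − s)/(D + 1))`, for which
`d_s(v₁, v₂)² − D² ≤ 4 (t − s)` (`exp_neg_sq_div_le_exp_half_mul_exp_neg_sq_div`).
[cite: Bamler2020Entropy, §7.3, proof of the Gaussian lemma, (7.21)–(7.22)]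
[cite: HeinNaber2014, §1.3, Gaussian concentration theorem] -/
theorem exists_mem_real_mul_real_le_exp_neg_edist_sq {s t : ℝ} (has : a < s) (hst : s < t)
    (htT : t ≤ T) (x : M) {A B : Set M} (hA : MeasurableSet A) (hB : MeasurableSet B)
    (hAne : A.Nonempty) (hBne : B.Nonempty) :
    ∃ v₁ ∈ A, ∃ v₂ ∈ B,
      (heatKernelMeasure hh hR t x s).real A * (heatKernelMeasure hh hR t x s).real B ≤
        Real.exp (1 / 2) * Real.exp (-((h s).edist (hR s) v₁ v₂).toReal ^ 2 / (8 * (t - s))) := by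
  letI : MetricSpace M := (h s).metricSpace (hR s)
  have hσ : 0 < t - s := sub_pos.2 hst
  -- the `1`-Lipschitz witness `ψ = d_s(·, A)`
  set ψ : M → ℝ := fun w ↦ Metric.infDist w A
  have hψc : Continuous ψ := Metric.continuous_infDist_pt A
  have hψ : ∀ y z, ENNReal.ofReal |ψ y - ψ z| ≤ (h s).edist (hR s) y z := by
    intro y z
    have h1 : |ψ y - ψ z| ≤ dist y z := by
      have h2 := (Metric.lipschitz_infDist_pt A).dist_le_mul y z
      rwa [NNReal.coe_one, one_mul, Real.dist_eq] at h2
    calc ENNReal.ofReal |ψ y - ψ z| ≤ ENNReal.ofReal (dist y z) := ENNReal.ofReal_le_ofReal h1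
      _ = edist y z := (edist_dist y z).symm
      _ = (h s).edist (hR s) y z := metricSpace_edist (hR s) y z
  have hAα : ∀ y ∈ A, ψ y ≤ 0 := fun y hy ↦ (Metric.infDist_zero_of_mem hy).le
  -- the set distance `D = inf_B ψ`
  set D : ℝ := sInf (ψ '' B)
  have hbdd : BddBelow (ψ '' B) := ⟨0, by rintro _ ⟨y, -, rfl⟩; exact Metric.infDist_nonneg⟩
  have hD0 : 0 ≤ D := Real.sInf_nonneg (by rintro _ ⟨y, -, rfl⟩; exact Metric.infDist_nonneg)
  have hBα : ∀ y ∈ B, 0 + D ≤ ψ y := fun y hy ↦ by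
    rw [zero_add]
    exact csInf_le hbdd (mem_image_of_mem ψ hy)
  -- Hein–Naber
  have hmain := heatKernelMeasure_real_mul_real_le_exp hflow hh hR has hst htT x hψc hψ hA hB hD0
    hAα hBα
  -- near-minimizers
  set δ : ℝ := min 1 ((t - s) / (D + 1))
  have hD1 : 0 < D + 1 := by linarith
  have hδ : 0 < δ := lt_min one_pos (div_pos hσ hD1)
  have hδ1 : δ ≤ 1 := min_le_left _ _
  have hδσ : δ * (D + 1) ≤ t - s := by
    rw [← le_div_iff₀ hD1]
    exact min_le_right _ _
  obtain ⟨_, ⟨v₂, hv₂B, rfl⟩, hv₂⟩ := Real.lt_sInf_add_pos (hBne.image ψ) hδ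
  obtain ⟨v₁, hv₁A, hv₁⟩ := (Metric.infDist_lt_iff hAne).1 (lt_add_of_pos_right (ψ v₂) hδ)
  refine ⟨v₁, hv₁A, v₂, hv₂B, hmain.trans ?_⟩
  have hdv : dist v₂ v₁ = ((h s).edist (hR s) v₁ v₂).toReal := by
    rw [dist_comm]
    exact metricSpace_dist (hR s) v₁ v₂
  have hlt : ((h s).edist (hR s) v₁ v₂).toReal < D + 2 * δ := by
    rw [← hdv]
    change Metric.infDist v₂ A < D + δ at hv₂
    linarith
  exact exp_neg_sq_div_le_exp_half_mul_exp_neg_sq_div hσ ENNReal.toReal_nonneg hδ hδ1 hδσ hlt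

end Kernel

end Literature.Geometry.Riemannian

end
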